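import Summits.MatrixMultiplication.OmegaCensus.BoxUsefulSecondCentre
import Summits.MatrixMultiplication.OmegaCensus.BoxBadD24Config
import Summits.MatrixMultiplication.OmegaCensus.BoxBadD18Config

/-!
# ω-census, family (b3): conjecture C9 (b) — tools for the centre-lifting theorem: odd second-central elements, and the `D₁₈ / D₂₄` endgame

HONEST FRAMING (pub-omega census; verbatim): lottery ticket; floor = certified bounds/negative ranges.
Census BOOKKEEPING (conjecture C9 of the cell, STRUCTURE.md §2; pub-omega kernel-l4 gen 16, task K-5, structure part; first half
of the centre-lifting theorem `BoxUsefulCentreLift`).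
* `SecondCentre.mem_center_of_odd`: in a box-useful group a second-central element of ODD order is central (prime by prime from
  `mem_center_of_orderOf_odd_prime_pow`); `SecondCentre.comm_of_odd`: a second-central element commutes with every element of odd
  order (Bézout split into `2`-part and odd part).  So `Z₂(G)/Z(G)` is a `2`-group and `Z₂(G)` centralises all odd-order elements.
* `CentreLift.core` — THE ENDGAME: a `3`-element `a ≠ 1` inverted by `x` and centralised by a second-central `2`-element `y` with
  `⁅y, x⁆ ≠ 1` is impossible in a box-useful group: if `9 ∣ |a|` the `D₁₈`-configuration (`BoxBadD18Config`) applies to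
  `(a^{|a|/9}, x)`, otherwise `a³ = 1` and, with `y' = y^{2^{e-1}}` making `c = ⁅y', x⁆` a central involution, `(a, x, y', c)`
  is the `D₂₄`-configuration (`BoxBadD24Config`).
* small helpers: Bézout membership, powers coprime to the order, `⁅wu, g⁆ = ⁅u, g⁆` for central `w`, `(srs⁻¹)ⁿ = srⁿs⁻¹`.
Nothing here is progress on `ω`.
-/

namespace Summit.MatrixMultiplication.OmegaCensus

open Finset ProductBoxBound
open scoped commutatorElement

namespace SecondCentre

variable {G : Type*} [Group G] [Fintype G] [DecidableEq G] {u : G}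

omit [Fintype G] [DecidableEq G] in
/-- Powers of second-central elements are second-central. [folklore] -/
theorem pow_secondCentral (hu : ∀ g : G, ⁅u, g⁆ ∈ Subgroup.center G) (n : ℕ) (g : G) :
    ⁅u ^ n, g⁆ ∈ Subgroup.center G := by
  rw [comm_pow_left hu]; exact Subgroup.pow_mem _ (hu g) n

/-- **Second-central elements of ODD order are central in a box-useful group.** [folklore] -/
theorem mem_center_of_odd (hG : BoxUseful G) (hu : ∀ g : G, ⁅u, g⁆ ∈ Subgroup.center G) (hodd : Odd (orderOf u)) :
    u ∈ Subgroup.center G := by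
  classical
  rw [Subgroup.mem_center_iff]
  intro g
  suffices h : ⁅u, g⁆ = 1 by exact ((comm_eq_one_iff u g).1 h).symm
  by_contra hz
  set z := ⁅u, g⁆ with hzdef
  have hz1 : orderOf z ≠ 1 := fun h => hz (orderOf_eq_one_iff.mp h)
  -- a prime `p ∣ orderOf z`; it divides the odd number `orderOf u`
  set p := (orderOf z).minFac with hpdef
  haveI hp : Fact p.Prime := ⟨Nat.minFac_prime hz1⟩
  have hpz : p ∣ orderOf z := Nat.minFac_dvd _
  have hzu : orderOf z ∣ orderOf u := orderOf_comm_dvd_left hu g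
  have hpu : p ∣ orderOf u := hpz.trans hzu
  have hpodd : Odd p := hodd.of_dvd_nat hpu
  -- `orderOf u = p^a * m'`, `p ∤ m'`; `v = u^{m'}` has order `p^a`, is second-central, hence central
  obtain ⟨a, m', hm', hn⟩ := Nat.exists_eq_pow_mul_and_not_dvd (orderOf_pos u).ne' p hp.out.ne_one
  have hv : orderOf (u ^ m') = p ^ a := by
    rw [orderOf_pow' u (fun h => by rw [h, mul_zero] at hn; exact (orderOf_pos u).ne' hn), hn,
      Nat.gcd_eq_right (Dvd.intro_left (p ^ a) rfl), Nat.mul_div_cancel _ (Nat.pos_of_ne_zero (fun h => by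
        rw [h, mul_zero] at hn; exact (orderOf_pos u).ne' hn))]
  have hvc : u ^ m' ∈ Subgroup.center G :=
    mem_center_of_orderOf_odd_prime_pow hG hpodd (pow_secondCentral hu m') hv
  -- so `⁅u, g⁆^{m'} = ⁅u^{m'}, g⁆ = 1`, i.e. `orderOf z ∣ m'`, contradicting `p ∣ orderOf z`, `p ∤ m'`
  have hzm : z ^ m' = 1 := by
    rw [hzdef, ← comm_pow_left hu, (comm_eq_one_iff _ _).2]
    exact (Subgroup.mem_center_iff.mp hvc g).symm
  exact hm' (hpz.trans (orderOf_dvd_of_pow_eq_one hzm))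

/-- **Second-central elements commute with every element of odd order** (box-useful group). [folklore] -/
theorem comm_of_odd (hG : BoxUseful G) (hu : ∀ g : G, ⁅u, g⁆ ∈ Subgroup.center G) {g : G} (hg : Odd (orderOf g)) :
    u * g = g * u := by
  classical
  obtain ⟨k, m, hm, hn⟩ := Nat.exists_eq_two_pow_mul_odd (orderOf_pos u).ne'
  have h2k : (2 : ℕ) ^ k ≠ 0 := pow_ne_zero _ two_ne_zero
  -- odd part `u^(2^k)` is central
  have hy : Odd (orderOf (u ^ 2 ^ k)) := by
    rw [orderOf_pow' u h2k, hn, Nat.gcd_eq_right (Dvd.intro m rfl), Nat.mul_div_cancel_left m (Nat.pos_of_ne_zero h2k)]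
    exact hm
  have hyc : u ^ 2 ^ k ∈ Subgroup.center G := mem_center_of_odd hG (pow_secondCentral hu _) hy
  -- `2`-part `u^m` commutes with `g` by coprimality
  have hx : ⁅u ^ m, g⁆ = 1 := by
    apply comm_eq_one_of_coprime (pow_secondCentral hu m)
    have hxo : orderOf (u ^ m) = 2 ^ k := by
      rw [orderOf_pow' u (fun h => by rw [h, mul_zero] at hn; exact (orderOf_pos u).ne' hn), hn,
        Nat.gcd_eq_right (Dvd.intro_left (2 ^ k) rfl), Nat.mul_div_cancel _ (Nat.pos_of_ne_zero (fun h => by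
          rw [h, mul_zero] at hn; exact (orderOf_pos u).ne' hn))]
    rw [hxo]
    exact Nat.Coprime.pow_left k ((Nat.Prime.coprime_iff_not_dvd Nat.prime_two).mpr hg.not_two_dvd_nat)
  have hxg : u ^ m * g = g * u ^ m := (comm_eq_one_iff _ _).1 hx
  -- Bézout
  have hcop : Nat.Coprime (2 ^ k) m :=
    Nat.Coprime.pow_left k ((Nat.Prime.coprime_iff_not_dvd Nat.prime_two).mpr hm.not_two_dvd_nat)
  have hbez : ((2 ^ k : ℕ) : ℤ) * Nat.gcdA (2 ^ k) m + (m : ℤ) * Nat.gcdB (2 ^ k) m = 1 := by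
    rw [← Nat.gcd_eq_gcd_ab, Nat.Coprime.gcd_eq_one hcop]; rfl
  have hdec : u = (u ^ 2 ^ k) ^ Nat.gcdA (2 ^ k) m * (u ^ m) ^ Nat.gcdB (2 ^ k) m := by
    calc u = u ^ (1 : ℤ) := (zpow_one u).symm
      _ = u ^ (((2 ^ k : ℕ) : ℤ) * Nat.gcdA (2 ^ k) m + (m : ℤ) * Nat.gcdB (2 ^ k) m) := by rw [hbez]
      _ = (u ^ 2 ^ k) ^ Nat.gcdA (2 ^ k) m * (u ^ m) ^ Nat.gcdB (2 ^ k) m := by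
          rw [zpow_add, zpow_mul, zpow_mul, zpow_natCast, zpow_natCast]
  have h1 : (u ^ 2 ^ k) ^ Nat.gcdA (2 ^ k) m * g = g * (u ^ 2 ^ k) ^ Nat.gcdA (2 ^ k) m :=
    (Subgroup.mem_center_iff.mp (Subgroup.zpow_mem _ hyc _) g).symm
  have h2 : (u ^ m) ^ Nat.gcdB (2 ^ k) m * g = g * (u ^ m) ^ Nat.gcdB (2 ^ k) m :=
    ((show Commute (u ^ m) g from hxg).zpow_left _).eq
  rw [hdec, mul_assoc, h2, ← mul_assoc, h1, mul_assoc]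

end SecondCentre

namespace CentreLift

variable {G : Type*} [Group G] [Fintype G] [DecidableEq G]

omit [DecidableEq G] in
/-- The `2`-part of an element: `g ^ m` where `orderOf g = 2^k · m`, `m` odd; it has order `2^k`. [folklore] -/
theorem orderOf_pow_oddPart {g : G} {k m : ℕ} (hn : orderOf g = 2 ^ k * m) : orderOf (g ^ m) = 2 ^ k := by
  have hm0 : m ≠ 0 := fun h => by rw [h, mul_zero] at hn; exact (orderOf_pos g).ne' hn
  rw [orderOf_pow' g hm0, hn, Nat.gcd_eq_right (Dvd.intro_left (2 ^ k) rfl), Nat.mul_div_cancel _ (Nat.pos_of_ne_zero hm0)]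

omit [Fintype G] [DecidableEq G] in
/-- If `u^a, u^b ∈ H` with `a, b` coprime then `u ∈ H` (Bézout). [folklore] -/
theorem mem_of_coprime_pow_mem (H : Subgroup G) {u : G} {a b : ℕ} (hab : a.Coprime b) (ha : u ^ a ∈ H)
    (hb : u ^ b ∈ H) : u ∈ H := by
  have hbez : ((a : ℕ) : ℤ) * Nat.gcdA a b + (b : ℤ) * Nat.gcdB a b = 1 := by
    rw [← Nat.gcd_eq_gcd_ab, Nat.Coprime.gcd_eq_one hab]; rfl
  have hdec : u = (u ^ a) ^ Nat.gcdA a b * (u ^ b) ^ Nat.gcdB a b := by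
    calc u = u ^ (1 : ℤ) := (zpow_one u).symm
      _ = u ^ (((a : ℕ) : ℤ) * Nat.gcdA a b + (b : ℤ) * Nat.gcdB a b) := by rw [hbez]
      _ = (u ^ a) ^ Nat.gcdA a b * (u ^ b) ^ Nat.gcdB a b := by
          rw [zpow_add, zpow_mul, zpow_mul, zpow_natCast, zpow_natCast]
  rw [hdec]
  exact H.mul_mem (H.zpow_mem ha _) (H.zpow_mem hb _)

omit [Fintype G] [DecidableEq G] in
/-- A non-trivial element does not die under a power coprime to its order. [folklore] -/
theorem pow_ne_one_of_coprime {z : G} (hz : z ≠ 1) {n : ℕ} (h : (orderOf z).Coprime n) : z ^ n ≠ 1 := by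
  intro hzn
  apply hz
  rw [← orderOf_eq_one_iff]
  exact Nat.Coprime.eq_one_of_dvd h (orderOf_dvd_of_pow_eq_one hzn)

omit [Fintype G] [DecidableEq G] in
/-- `⁅w u, g⁆ = ⁅u, g⁆` for central `w`. [folklore] -/
theorem comm_central_mul {w u : G} (hw : w ∈ Subgroup.center G) (g : G) : ⁅w * u, g⁆ = ⁅u, g⁆ := by
  have hwc := Subgroup.mem_center_iff.mp hw
  rw [commutatorElement_def, commutatorElement_def]
  calc w * u * g * (w * u)⁻¹ * g⁻¹ = w * u * g * u⁻¹ * (w⁻¹ * g⁻¹) := by group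
    _ = w * u * g * u⁻¹ * (g⁻¹ * w⁻¹) := by congr 1; rw [← mul_inv_rev, ← mul_inv_rev, hwc]
    _ = w * (u * g * u⁻¹ * g⁻¹) * w⁻¹ := by group
    _ = u * g * u⁻¹ * g⁻¹ := by rw [← hwc]; group

omit [Fintype G] [DecidableEq G] in
/-- `(s r s⁻¹)^n = s r^n s⁻¹`. [folklore] -/
theorem conj_pow' (s r : G) (n : ℕ) : (s * r * s⁻¹) ^ n = s * r ^ n * s⁻¹ := by
  have := map_pow (MulAut.conj s) r n
  simp only [MulAut.conj_apply] at this
  exact this.symm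

omit [Fintype G] [DecidableEq G] in
/-- An element of `3`-power order has odd order. [folklore] -/
theorem odd_orderOf_of_pow_three {r : G} {b : ℕ} (hr : r ^ 3 ^ b = 1) : Odd (orderOf r) := by
  obtain ⟨c, -, hc⟩ := (Nat.dvd_prime_pow Nat.prime_three).1 (orderOf_dvd_of_pow_eq_one hr)
  rw [hc]; exact Odd.pow (by decide)

/-- **The endgame.** A `3`-element `a ≠ 1` inverted by `x` and centralised by a second-central `2`-element `y` with
`⁅y, x⁆ ≠ 1` contradicts box-usefulness: `D₁₈`-configuration if `9 ∣ |a|`, `D₂₄`-configuration otherwise. [folklore] -/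
theorem core (hG : BoxUseful G) {a x y : G} {b : ℕ} (ha : a ^ 3 ^ b = 1) (ha1 : a ≠ 1) (hxa : x * a * x⁻¹ = a⁻¹)
    (hya : y * a = a * y) (hy : ∀ g : G, ⁅y, g⁆ ∈ Subgroup.center G) (hyx : ⁅y, x⁆ ≠ 1)
    (hy2 : ∃ j : ℕ, orderOf y = 2 ^ j) : False := by
  classical
  -- `orderOf a = 3^c` with `c ≥ 1`
  obtain ⟨c, -, hc⟩ := (Nat.dvd_prime_pow Nat.prime_three).1 (orderOf_dvd_of_pow_eq_one ha)
  have hc1 : 1 ≤ c := by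
    by_contra h0
    have : c = 0 := by omega
    rw [this, pow_zero, orderOf_eq_one_iff] at hc
    exact ha1 hc
  by_cases hc2 : 2 ≤ c
  · -- `D₁₈`: `a₉ = a^(3^(c-2))` has order `9`
    set a₉ := a ^ 3 ^ (c - 2) with ha₉
    have h9 : orderOf a₉ = 9 := by
      rw [ha₉, orderOf_pow' a (pow_ne_zero _ (by norm_num)), hc, Nat.gcd_eq_right (pow_dvd_pow 3 (by omega)),
        Nat.pow_div (by omega) (by norm_num)]
      have : c - (c - 2) = 2 := by omega
      rw [this]
    have ha9 : a₉ ^ 9 = 1 := by rw [← h9]; exact pow_orderOf_eq_one a₉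
    have ha3 : a₉ ^ 3 ≠ 1 := pow_ne_one_of_lt_orderOf (by norm_num) (by rw [h9]; norm_num)
    have hxa9 : x * a₉ * x⁻¹ = a₉⁻¹ := by rw [ha₉, ← conj_pow', hxa, inv_pow]
    exact D18Config.not_boxUseful ha9 ha3 hxa9 hG
  · -- `D₂₄`: `a³ = 1`
    have hc' : c = 1 := by omega
    rw [hc', pow_one] at hc
    have ha3 : a ^ 3 = 1 := by rw [← hc]; exact pow_orderOf_eq_one a
    -- the central commutator `c₀ = ⁅y, x⁆` of order `2^e`, `e ≥ 1`; `y' = y^(2^(e-1))` gives an involution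
    obtain ⟨j, hj⟩ := hy2
    obtain ⟨e, -, he⟩ := (Nat.dvd_prime_pow Nat.prime_two).1 (hj ▸ SecondCentre.orderOf_comm_dvd_left hy x)
    have he1 : 1 ≤ e := by
      by_contra h0
      have : e = 0 := by omega
      rw [this, pow_zero, orderOf_eq_one_iff] at he
      exact hyx he
    set y' := y ^ 2 ^ (e - 1) with hy'
    set c₁ := ⁅y', x⁆ with hc₁
    have hc₁e : c₁ = ⁅y, x⁆ ^ 2 ^ (e - 1) := by rw [hc₁, hy', SecondCentre.comm_pow_left hy]
    have hoc : orderOf c₁ = 2 := by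
      rw [hc₁e, orderOf_pow' _ (pow_ne_zero _ two_ne_zero), he, Nat.gcd_eq_right (pow_dvd_pow 2 (by omega)),
        Nat.pow_div (by omega) (by norm_num)]
      have : e - (e - 1) = 1 := by omega
      rw [this, pow_one]
    have hc₁1 : c₁ ≠ 1 := fun h => by rw [h, orderOf_one] at hoc; exact absurd hoc (by norm_num)
    have hc₁2 : c₁ ^ 2 = 1 := by rw [← hoc]; exact pow_orderOf_eq_one c₁
    have hc₁Z : c₁ ∈ Subgroup.center G := by rw [hc₁e]; exact Subgroup.pow_mem _ (hy x) _
    have hcinv : c₁⁻¹ = c₁ := by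
      rw [eq_comm, ← mul_eq_one_iff_eq_inv', ← pow_two, hc₁2]
    have hcc := Subgroup.mem_center_iff.mp hc₁Z
    -- the `D₂₄` data with `c = c₁`
    have hxy : x * y' * x⁻¹ * y'⁻¹ = c₁ := by
      rw [← hcinv, hc₁, commutatorElement_def]; group
    have hya' : y' * a = a * y' := ((show Commute y a from hya).pow_left _).eq
    exact D24Config.not_boxUseful ha3 hc₁2 (hcc a).symm ha1 hc₁1 hxa hya' hxy (hcc x).symm (hcc y').symm hG

end CentreLift

end Summit.MatrixMultiplication.OmegaCensus
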